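import Summits.Ventures.YMGap.Thresholds.SharpClusteringBochner
import Summits.Ventures.YMGap.Thresholds.LatticeBakryEmeryL2
import HarnessLib

/-!
# Hessian-currency items on `SU(N)^ι`: homogeneity of `D_V D_V` and polarisation of a localised Hessian bound

TREE-SHAPED LIFT (cell `ym-beyond`, HUMAN RULINGS D-0035 / D-0037): part 1 of 3 of seat ym-beyond-p4 g8's
`HOME/LIFT-P4Y2-LatticeBakryEmeryC2Density.lean` (sha16 dc5fd6e06aaf8b9f, referee PASS baseline v0.8 §5g7), split at its own
section boundaries to meet the 400-line rule; filed by the cell's literature seat (ym-beyond-lit g3) on P4's WANTED N5(b)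
(P4 has no filing rights). Bodies verbatim; namespace `Summit.Ventures.YMGap.LatticeBakryEmery` as intended by P4.

CONTENT (= the lift file's §1 «currency items used», from `HOME/ROUTE-P4Y2-Sketch.lean` v6 §5, §5b): `algD_algD_smul_dir`
(`D_{cA} D_{cA} F = c² D_A D_A F`), the scalar optimisation `le_two_mul_sqrt_of_forall`, the single-link direction lemmas
(`lk_add_apply`, `skew_lk`, `trace_lk`, …, `sum_frobNorm_sq_lk(_add)`), and ★★ `offDiagHessBound_of_hessBoundOn`: a Hessian bound
localised on `X`, `|D_V D_V F| ≤ Λ Σ_{e∈X} ‖V_e‖_F²`, gives the off-diagonal profile `OffDiagHessBound F (2Λ·1_{e,e'∈X})`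
(polarisation of commuting single-link derivatives + optimal scaling).  Consumers: `LatticeBakryEmeryC2Density`
(`c2PolyApprox_of_contDiff`).  No `Prop` is declared; nothing about Yang–Mills is asserted. [folklore]
-/

noncomputable section

open scoped Matrix ComplexConjugate BigOperators Matrix.Norms.Frobenius ContDiff Topology
open Matrix Complex Finset MeasureTheory Filter
open Literature.MathematicalPhysics.QuantumFieldTheory
open Literature.MathematicalPhysics.QuantumFieldTheory.SUNBakryEmery (SUN FrameIdx frame expSU coe_expSU coordFn coordMat CoordIdx
  coordFn_true coordFn_false re_trace_mul_eq_sum)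

namespace Summit.Ventures.YMGap

namespace LatticeBakryEmery

open Summit.Ventures.YMGap.SharpClustering

universe u

variable {ι : Type u} [Fintype ι] [DecidableEq ι] {N : ℕ}

/-! ## 1. Currency items used: homogeneity and polarisation (from the cell sketch §5, §5b) -/


omit [Fintype ι] [DecidableEq ι] in
/-- `‖t X‖_F = |t| ‖X‖_F` for real `t`. [folklore] -/
private theorem frobNorm_real_smul (t : ℝ) (X : Matrix (Fin N) (Fin N) ℂ) : frobNorm (t • X) = |t| * frobNorm X := by
  rw [frobNorm_eq_norm, frobNorm_eq_norm, norm_smul, Real.norm_eq_abs]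

omit [DecidableEq ι] in
/-- Homogeneity of the second derivative in the direction: `D_{cA} D_{cA} F = c² D_A D_A F`. [folklore] -/
theorem algD_algD_smul_dir {F : Cfg ι N → ℝ} (hF : ContDiff ℝ ∞ F) (c : ℝ) (A Q : Cfg ι N) :
    algD (c • A) (algD (c • A) F) Q = c ^ 2 * algD A (algD A F) Q := by
  have h1 : (c • algD A F : Cfg ι N → ℝ) = fun Q => c * algD A F Q :=
    funext fun Q => by simp only [Pi.smul_apply, smul_eq_mul]
  rw [algD_smul_dir c A F, h1, algD_smul_dir, Pi.smul_apply, smul_eq_mul,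
    algD_const_mul (contDiff_algD hF A) c A]
  ring

/-- Optimising `t² a + b/t²` over `t > 0`. [folklore] -/
theorem le_two_mul_sqrt_of_forall {x Λ a b : ℝ} (hΛ : 0 ≤ Λ) (ha : 0 ≤ a) (hb : 0 ≤ b)
    (h : ∀ t : ℝ, 0 < t → x ≤ Λ * (t ^ 2 * a + b / t ^ 2)) : x ≤ 2 * Λ * Real.sqrt a * Real.sqrt b := by
  rcases ha.eq_or_lt with ha0 | hapos
  · rw [← ha0, Real.sqrt_zero, mul_zero, zero_mul]
    by_contra hx'
    have hx : 0 < x := not_le.1 hx'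
    have hpos : 0 < Λ * b + 1 := by positivity
    have hq : 0 < (Λ * b + 1) / x := div_pos hpos hx
    have := h (Real.sqrt ((Λ * b + 1) / x)) (Real.sqrt_pos.2 hq)
    rw [← ha0, mul_zero, zero_add, Real.sq_sqrt hq.le] at this
    have key : Λ * (b / ((Λ * b + 1) / x)) = x * (Λ * b / (Λ * b + 1)) := by
      field_simp
    have hlt : Λ * b / (Λ * b + 1) < 1 := (div_lt_one hpos).2 (by linarith)
    have h3 : x * (Λ * b / (Λ * b + 1)) < x * 1 := mul_lt_mul_of_pos_left hlt hx
    linarith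
  · rcases hb.eq_or_lt with hb0 | hbpos
    · rw [← hb0, Real.sqrt_zero, mul_zero]
      by_contra hx'
      have hx : 0 < x := not_le.1 hx'
      have hpos : 0 < 2 * (Λ * a + 1) := by positivity
      have hq : 0 < x / (2 * (Λ * a + 1)) := div_pos hx hpos
      have := h (Real.sqrt (x / (2 * (Λ * a + 1)))) (Real.sqrt_pos.2 hq)
      rw [← hb0, zero_div, add_zero, Real.sq_sqrt hq.le] at this
      have key : Λ * (x / (2 * (Λ * a + 1)) * a) = x * (Λ * a / (2 * (Λ * a + 1))) := by ring
      rw [key] at this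
      have hlt : Λ * a / (2 * (Λ * a + 1)) < 1 := (div_lt_one hpos).2 (by nlinarith)
      have h3 : x * (Λ * a / (2 * (Λ * a + 1))) < x * 1 := mul_lt_mul_of_pos_left hlt hx
      linarith
    · set sa := Real.sqrt a with hsa
      set sb := Real.sqrt b with hsb
      have hsa0 : 0 < sa := Real.sqrt_pos.2 hapos
      have hsb0 : 0 < sb := Real.sqrt_pos.2 hbpos
      have ha' : a = sa ^ 2 := (Real.sq_sqrt ha).symm
      have hb' : b = sb ^ 2 := (Real.sq_sqrt hb).symm
      have hq : 0 < sb / sa := div_pos hsb0 hsa0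
      have := h (Real.sqrt (sb / sa)) (Real.sqrt_pos.2 hq)
      rw [Real.sq_sqrt hq.le, ha', hb'] at this
      have key : Λ * (sb / sa * sa ^ 2 + sb ^ 2 / (sb / sa)) = 2 * Λ * sa * sb := by
        field_simp
        ring
      linarith

variable {ι : Type u} [Fintype ι] [DecidableEq ι] {N : ℕ}

omit [Fintype ι] in
/-- Evaluation of a two-link direction. [folklore] -/
theorem lk_add_apply (e e' e'' : ι) (Z W : Matrix (Fin N) (Fin N) ℂ) :
    (lk e Z + lk e' W) e'' = (if e'' = e then Z else 0) + (if e'' = e' then W else 0) := by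
  simp only [Pi.add_apply, lk, Pi.single_apply]

omit [Fintype ι] in
/-- A single-link direction with skew-Hermitian entry is skew-Hermitian in every link. [folklore] -/
theorem skew_lk {e : ι} {Z : Matrix (Fin N) (Fin N) ℂ} (hZ : Zᴴ = -Z) (e'' : ι) :
    ((lk e Z) e'')ᴴ = -(lk e Z) e'' := by
  simp only [lk, Pi.single_apply]
  split_ifs <;> simp [hZ]

omit [Fintype ι] in
/-- A single-link direction with traceless entry is traceless in every link. [folklore] -/
theorem trace_lk {e : ι} {Z : Matrix (Fin N) (Fin N) ℂ} (hZ : Z.trace = 0) (e'' : ι) :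
    ((lk e Z) e'').trace = 0 := by
  simp only [lk, Pi.single_apply]
  split_ifs <;> simp [hZ]

omit [Fintype ι] in
/-- A two-link direction with skew-Hermitian entries is skew-Hermitian in every link. [folklore] -/
theorem skew_lk_add {e e' : ι} {Z W : Matrix (Fin N) (Fin N) ℂ} (hZ : Zᴴ = -Z) (hW : Wᴴ = -W) (e'' : ι) :
    ((lk e Z + lk e' W) e'')ᴴ = -(lk e Z + lk e' W) e'' := by
  rw [lk_add_apply]
  split_ifs
  · rw [Matrix.conjTranspose_add, hZ, hW, neg_add]
  · rw [add_zero, hZ]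
  · rw [zero_add, hW]
  · rw [add_zero, Matrix.conjTranspose_zero, neg_zero]

omit [Fintype ι] in
/-- A two-link direction with traceless entries is traceless in every link. [folklore] -/
theorem trace_lk_add {e e' : ι} {Z W : Matrix (Fin N) (Fin N) ℂ} (hZ : Z.trace = 0) (hW : W.trace = 0) (e'' : ι) :
    ((lk e Z + lk e' W) e'').trace = 0 := by
  rw [lk_add_apply, Matrix.trace_add]
  split_ifs <;> simp [hZ, hW]

omit [Fintype ι] in
/-- `Σ_{e''∈X} ‖(lk e Z) e''‖² = 1_{e∈X} ‖Z‖²`. [folklore] -/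
theorem sum_frobNorm_sq_lk (e : ι) (Z : Matrix (Fin N) (Fin N) ℂ) (X : Finset ι) :
    ∑ e'' ∈ X, frobNorm ((lk e Z) e'') ^ 2 = if e ∈ X then frobNorm Z ^ 2 else 0 := by
  have hpt : ∀ e'', frobNorm ((lk e Z) e'') ^ 2 = if e'' = e then frobNorm Z ^ 2 else 0 := by
    intro e''
    simp only [lk, Pi.single_apply]
    split_ifs
    · rfl
    · rw [frobNorm_zero]; ring
  simp_rw [hpt]
  exact Finset.sum_ite_eq' X e _

omit [Fintype ι] in
/-- `Σ_{e''∈X} ‖(lk e Z + lk e' W) e''‖² = 1_{e∈X}‖Z‖² + 1_{e'∈X}‖W‖²` for `e ≠ e'`. [folklore] -/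
theorem sum_frobNorm_sq_lk_add {e e' : ι} (hne : e ≠ e') (Z W : Matrix (Fin N) (Fin N) ℂ) (X : Finset ι) :
    ∑ e'' ∈ X, frobNorm ((lk e Z + lk e' W) e'') ^ 2 =
      (if e ∈ X then frobNorm Z ^ 2 else 0) + (if e' ∈ X then frobNorm W ^ 2 else 0) := by
  have hpt : ∀ e'', frobNorm ((lk e Z + lk e' W) e'') ^ 2 =
      (if e'' = e then frobNorm Z ^ 2 else 0) + (if e'' = e' then frobNorm W ^ 2 else 0) := by
    intro e''
    rw [lk_add_apply]
    by_cases h1 : e'' = e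
    · subst h1
      rw [if_pos rfl, if_neg hne, if_pos rfl, if_neg hne, add_zero, add_zero]
    · by_cases h2 : e'' = e'
      · rw [if_neg h1, if_pos h2, if_neg h1, if_pos h2, zero_add, zero_add]
      · rw [if_neg h1, if_neg h2, if_neg h1, if_neg h2, add_zero, add_zero, frobNorm_zero]; ring
  simp_rw [hpt]
  rw [Finset.sum_add_distrib, Finset.sum_ite_eq' X e, Finset.sum_ite_eq' X e']

omit [DecidableEq ι] in
/-- `D_0 = 0`. [folklore] -/
theorem algD_zero_dir (F : Cfg ι N → ℝ) : algD (0 : Cfg ι N) F = 0 := by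
  funext Q; simp [algD_apply]

/-- ★★ **Polarisation: a Hessian bound localised on `X`, `|D_V D_V F| ≤ Λ Σ_{e∈X} ‖V_e‖_F²`, gives the off-diagonal profile
`OffDiagHessBound F (2Λ·1_{e,e'∈X})`** (polarisation of
commuting single-link derivatives + optimal scaling). [folklore] -/
theorem offDiagHessBound_of_hessBoundOn {F : Cfg ι N → ℝ} (hF : ContDiff ℝ ∞ F) {X : Finset ι} {Λ : ℝ} (hΛ : 0 ≤ Λ)
    (hB : ∀ (g : PSU ι N) (V : Cfg ι N), (∀ e, (V e)ᴴ = -V e) → (∀ e, (V e).trace = 0) →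
      |algD V (algD V F) (emb g)| ≤ Λ * ∑ e ∈ X, frobNorm (V e) ^ 2) :
    OffDiagHessBound F (fun e e' => if e ∈ X ∧ e' ∈ X then 2 * Λ else 0) := by
  intro g e e' hne Xm Ym hX hX0 hY hY0
  set a : ℝ := if e ∈ X then frobNorm Xm ^ 2 else 0 with ha
  set b : ℝ := if e' ∈ X then frobNorm Ym ^ 2 else 0 with hb
  have ha0 : 0 ≤ a := by rw [ha]; split_ifs <;> positivity
  have hb0 : 0 ≤ b := by rw [hb]; split_ifs <;> positivity
  -- single-link derivatives in different links commute
  have hcomm : ∀ (Z W : Matrix (Fin N) (Fin N) ℂ),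
      algD (lk e Z) (algD (lk e' W) F) (emb g) = algD (lk e' W) (algD (lk e Z) F) (emb g) := by
    intro Z W
    have h := congrFun (algD_comm hF (lk e Z) (lk e' W)) (emb g)
    rw [lk_mul_lk, lk_mul_lk, if_neg hne, if_neg (Ne.symm hne), sub_self, algD_zero_dir] at h
    simpa [sub_eq_zero] using h
  -- polarisation
  have hpol : ∀ (Z W : Matrix (Fin N) (Fin N) ℂ),
      2 * algD (lk e Z) (algD (lk e' W) F) (emb g) =
        algD (lk e Z + lk e' W) (algD (lk e Z + lk e' W) F) (emb g) -
          algD (lk e Z) (algD (lk e Z) F) (emb g) - algD (lk e' W) (algD (lk e' W) F) (emb g) := by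
    intro Z W
    have hcZ := contDiff_algD hF (lk e Z)
    have hcW := contDiff_algD hF (lk e' W)
    rw [algD_add_dir (lk e Z) (lk e' W) F, algD_add_dir, algD_add hcZ hcW, algD_add hcZ hcW]
    simp only [Pi.add_apply]
    rw [hcomm Z W]; ring
  -- the bound for every `t > 0`
  have key : ∀ t : ℝ, 0 < t → |algD (lk e Xm) (algD (lk e' Ym) F) (emb g)| ≤ Λ * (t ^ 2 * a + b / t ^ 2) := by
    intro t ht
    have htne : t ≠ 0 := ht.ne'
    have hZs : (t • Xm)ᴴ = -(t • Xm) := by rw [Matrix.conjTranspose_smul, star_trivial, hX, smul_neg]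
    have hWs : (t⁻¹ • Ym)ᴴ = -(t⁻¹ • Ym) := by rw [Matrix.conjTranspose_smul, star_trivial, hY, smul_neg]
    have hZt : (t • Xm).trace = 0 := by rw [Matrix.trace_smul, hX0, smul_zero]
    have hWt : (t⁻¹ • Ym).trace = 0 := by rw [Matrix.trace_smul, hY0, smul_zero]
    -- `D_{tZ} D_{t⁻¹W} = D_Z D_W`
    have hsc : algD (lk e (t • Xm)) (algD (lk e' (t⁻¹ • Ym)) F) (emb g) =
        algD (lk e Xm) (algD (lk e' Ym) F) (emb g) := by
      have h1 : (t⁻¹ • algD (lk e' Ym) F : Cfg ι N → ℝ) = fun Q => t⁻¹ * algD (lk e' Ym) F Q :=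
        funext fun Q => by simp only [Pi.smul_apply, smul_eq_mul]
      rw [lk_smul, lk_smul, algD_smul_dir t, Pi.smul_apply, smul_eq_mul, algD_smul_dir t⁻¹, h1,
        algD_const_mul (contDiff_algD hF _) t⁻¹]
      field_simp
    have hV1 := hB g (lk e (t • Xm) + lk e' (t⁻¹ • Ym)) (skew_lk_add hZs hWs) (trace_lk_add hZt hWt)
    have hV2 := hB g (lk e (t • Xm)) (skew_lk hZs) (trace_lk hZt)
    have hV3 := hB g (lk e' (t⁻¹ • Ym)) (skew_lk hWs) (trace_lk hWt)
    rw [sum_frobNorm_sq_lk_add hne, frobNorm_real_smul, frobNorm_real_smul] at hV1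
    rw [sum_frobNorm_sq_lk, frobNorm_real_smul] at hV2
    rw [sum_frobNorm_sq_lk, frobNorm_real_smul] at hV3
    have e1 : (if e ∈ X then (|t| * frobNorm Xm) ^ 2 else 0) = t ^ 2 * a := by
      rw [ha]; split_ifs
      · rw [mul_pow, sq_abs]
      · ring
    have e2 : (if e' ∈ X then (|t⁻¹| * frobNorm Ym) ^ 2 else 0) = b / t ^ 2 := by
      rw [hb]; split_ifs
      · rw [mul_pow, sq_abs, inv_pow]; field_simp
      · ring
    rw [e1, e2] at hV1
    rw [e1] at hV2
    rw [e2] at hV3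
    have hp := hpol (t • Xm) (t⁻¹ • Ym)
    rw [hsc] at hp
    have habs : 2 * |algD (lk e Xm) (algD (lk e' Ym) F) (emb g)| ≤
        Λ * (t ^ 2 * a + b / t ^ 2) + Λ * (t ^ 2 * a) + Λ * (b / t ^ 2) := by
      rw [show 2 * |algD (lk e Xm) (algD (lk e' Ym) F) (emb g)| = |2 * algD (lk e Xm) (algD (lk e' Ym) F) (emb g)| by
        rw [abs_mul, abs_two], hp]
      have s1 := abs_sub (algD (lk e (t • Xm) + lk e' (t⁻¹ • Ym)) (algD (lk e (t • Xm) + lk e' (t⁻¹ • Ym)) F) (emb g) -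
        algD (lk e (t • Xm)) (algD (lk e (t • Xm)) F) (emb g)) (algD (lk e' (t⁻¹ • Ym)) (algD (lk e' (t⁻¹ • Ym)) F) (emb g))
      have s2 := abs_sub (algD (lk e (t • Xm) + lk e' (t⁻¹ • Ym)) (algD (lk e (t • Xm) + lk e' (t⁻¹ • Ym)) F) (emb g))
        (algD (lk e (t • Xm)) (algD (lk e (t • Xm)) F) (emb g))
      linarith
    linarith
  have hfin := le_two_mul_sqrt_of_forall hΛ ha0 hb0 key
  show |algD (lk e Xm) (algD (lk e' Ym) F) (emb g)| ≤ (if e ∈ X ∧ e' ∈ X then 2 * Λ else 0) * frobNorm Xm * frobNorm Ym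
  by_cases hc : e ∈ X ∧ e' ∈ X
  · rw [if_pos hc]
    rw [ha, hb, if_pos hc.1, if_pos hc.2, Real.sqrt_sq (frobNorm_nonneg _), Real.sqrt_sq (frobNorm_nonneg _)] at hfin
    linarith
  · rw [if_neg hc, zero_mul, zero_mul]
    have hz : Real.sqrt a * Real.sqrt b = 0 := by
      rcases not_and_or.1 hc with h | h
      · rw [ha, if_neg h, Real.sqrt_zero, zero_mul]
      · rw [hb, if_neg h, Real.sqrt_zero, mul_zero]
    have : 2 * Λ * Real.sqrt a * Real.sqrt b = 0 := by rw [mul_assoc, hz, mul_zero]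
    linarith

end LatticeBakryEmery

end Summit.Ventures.YMGap

end
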